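import Summits.BirchSwinnertonDyer.BirchSwinnertonDyer.Theorems.ErratumRoadFiveNonSurjCornerHybridShaAnCut
import Summits.BirchSwinnertonDyer.BirchSwinnertonDyer.Theorems.ErratumRoadFiveNonSurjCornerEulerHalfCornerOfTwinLower
import Summits.BirchSwinnertonDyer.BirchSwinnertonDyer.Theorems.ErratumRoadFiveNonSurjCornerTwinLowerSupplyNonSurj
import HarnessLib

/-!
# Route `ErratumRoadFive` (rung K2), crux `NonSurjCorner` (item stmt-BirchSwinnertonDyer-19065), registered line `Lines/hybrid.lean`:
# GLUE #8 — THE HYBRID COMPOSITION WITH SLOT 4 NARROWED TO THE CORNER'S NON-SURJECTIVE LEAF TWINS (RULING 48): the X11a lower half is consumed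
# ONLY at NON-SURJECTIVE X11a curves `Wd` with `p ∈ {5,7}`, `p ∣ ord_p Δ_min(Wd)` and non-unit `#Ш_an` — the population of item 19948;
# the §2 Shimura roads run on the TWIN-LOWER SUPPLY
# (cell `bsd-stepL`, seat `bsd-stepL-corner-p1` g16; `--supports stmt-BirchSwinnertonDyer-19065 --as helper`)

WHY THIS FILE. The registered skeleton r5 of `Cruxes/NonSurjCorner/Lines/hybrid.lean` (= this seat g14's r4a; planner g39, 03:51Z) composes the
crux through glue #7 (`nonSurjCorner_of_kolyZShaAn_of_twinMuAn_of_katoFacts_of_lowerX11aShaAn_of_sixNamedInputs_of_savedDisplay_of_threeBadSplit`,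
module `…HybridShaAnCut`), whose slot-4 binder `h₄an` is the X11a lower half at EVERY X11a curve with non-unit `#Ш_an` — as an obligation
EQUIVALENT to item 19064 `X11aLowerHalf` WHOLE (planner g39 RULING 48, x11a-ref g13: the `Ш_an` cut removes only trivially-true instances).
But every curve the line applies it to is a quadratic twist `E^{(d)}` of a corner curve `E` with `ρ̄_{E,p}` NOT surjective, and surjectivity
of `ρ̄_{·,p}` is a twist invariant (`Rank1Residual.Additive.surj_iff_of_model_twist`): the honest slot 4 is 19064's NON-surjective sub-leaf,
registered on 19064's own line as `stub_lowerNonSurjDeep` (`∀ Wd p, ClassX11a Wd p → ¬ Surj Wd p → ¬ X11a.ShaAnUnit Wd p →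
MissingLowerBoundAt Wd p`, `Cruxes/X11aLowerHalf/Lines/birth.lean`; its other stub `stub_lowerSurjDeep` — Skinner–Urban ∕ Skinner Thm C
without the ramified prime, IMC-grade — is then NOT in 19065's cone). Moreover the twist keeps `p ∣ ord_p Δ_min` (`p ∤ d_K`), so the curves
actually read are the corner's NON-SURJECTIVE LEAF TWINS — `ClassX11a Wd p ∧ ¬ Surj Wd p ∧ p ∈ {5,7} ∧ p ∣ ord_p Δ_min(Wd)` — EXACTLY the
population on which item 19948 `NonSurjCornerTwinMuAn` asks analytic `μ = 0` (slot 2): after this re-glue slots 2 and 4 of the line are the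
Euler half resp. the main-conjecture half of BSD(Wd, p) at the SAME rank-0 twins. RULING 48 made the narrowing the r5 turnkey; g15 took the
fallback (r5 := r4a) and recorded the re-glue as OWED. THIS FILE is the re-glue:
* §1 `X11b.erratumRoadFive_nonSurjCorner_of_kolyZShaAn_of_kolyJMax_of_multiUpper_of_lowerLeafTwinDeep_of_twinMultDivisibility` — §1 of
  `…HybridShaAnCut` VERBATIM with `h₄an` ↦ **`h₄ℓ`** (the lower half at the non-surjective LEAF twins with non-unit `#Ш_an`, `p ∈ {5,7}` —
  19064's `stub_lowerNonSurjDeep` restricted to 19948's twins); the X₀(N) MAX road's twin-leaf binder `hLtw` already carries `¬ Surj Wd p` and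
  `p ∣ ord_p Δ_min(Wd)`, so the narrowing is free there (unit case trivial).
* §2 **glue #8 `nonSurjCorner_of_kolyZShaAn_of_twinMuAn_of_katoFacts_of_lowerLeafTwinDeep_of_sixNamedInputs_of_savedDisplay_of_threeBadSplit`** —
  glue #7 with `h₄an` ↦ `h₄ℓ`; the §2 Shimura roads (inert `p`, split `p`, saved) now run on lane B corner3-p2 g6's per-pair TWIN-LOWER SUPPLY
  `Theorems.FHTwinLowerSupplyAt W p` (this seat g16 `…EulerHalfCornerOfTwinLower`: lane B's inert ∕ extra-place cores + the re-keyed split core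
  `…EulerHalfSplitOfTwinLower`), and the supply is produced ONCE per corner pair from Friedberg–Hoffstein ∧ `h₄ℓ`
  (`NonSurjCorner.fhTwinLowerSupplyAt_of_lowerLeafTwinDeep`, module `…TwinLowerSupplyNonSurj` §3: the twist is again non-surjective and keeps
  `p ∣ ord_p Δ_min`).
  Binders otherwise IDENTICAL to glue #7 (`hZan`, 19948, 19949, hMax (3 names), hShim6 (6 names), `hSav`, `hres3bad`); the Poitou–Tate sum
  formula and Barrios et al.'s `c₂` of twists are tree THEOREMS supplied inside.
Candidate composition of `Lines/hybrid.lean` r6 (slot 4 `stub_lowerX11a57` = 19064 WHOLE ↦ `stub_lowerLeafTwin57` := `h₄ℓ`'s statement; slots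
1–3, 5–7 unchanged) — delivered as evidence; registration is the planner's call (D-0145). 19064 WHOLE, and 19064's `stub_lowerNonSurjDeep`, each
imply `h₄ℓ` a fortiori (`lowerLeafTwinDeep_of_x11aLowerHalf`), so r5's composition factors through glue #8.

HONEST FRAMING: THEOREMS ONLY (no definition, no named fact, no `sorry`); CONDITIONAL on every displayed binder — the OPEN Kolyvagin
certificates on the `p ∣ #Ш_an` locus (structured `stub_kolyZShaAnDeep57`), the OPEN items 19948 (μ) ∕ 19949 (23 named Kato-side facts, three of
them flagged STRONGER-THAN-PRINT-BY-ι by ARM-P R-48, re-key to the contragredient twins pending T-TWIST-SEL-1) ∕ 19064's `stub_lowerNonSurjDeep`,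
the UNPROVED named inputs of the MAX form and of the Shimura roads, the OPEN saved display, the structural residual `hres3bad`; item 19065 is
NOT closed; no stub is discharged; nothing about any curve's BSD; BSD is not advanced; T7. Credit: lane B corner3-p2 g6 (twin-lower supply and
re-keyed cores), b2b (`surj_iff_of_model_twist`), x11a-ref g13 ∕ planner g39 (RULING 48), bsd-line-x11a-p1 (19064's line and stub names).
References (locators only): [cite: Miller2011LMS, §1 and Def. 1.1] [cite: Cha2005, Thm. 21 and Rmk. 25] [cite: JetchevSkinnerWan2017, §7.4.1–7.4.2]
[cite: SilvermanAEC2009, X.5 Cor. 5.4] [cite: FriedbergHoffstein1995, Thm. B] [cite: GrossZagier1986, V §2 (2.2)].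
-/

set_option autoImplicit false
set_option linter.dupNamespace false -- `Summit.BirchSwinnertonDyer.BirchSwinnertonDyer` (summit = problem), tree-wide

noncomputable section

open scoped Classical NumberField MatrixGroups ModularForm

namespace Summit.BirchSwinnertonDyer.Rank1Residual.X11b

open CongruenceSubgroup WeierstrassCurve NumberField IsDedekindDomain Field
  Literature.NumberTheory.EllipticCurves
  Literature.NumberTheory.EllipticCurves.ModularForms
  Literature.NumberTheory.EllipticCurves.Rank1Residual
  Literature.NumberTheory.EllipticCurves.Rank1Residual.Typed
  Literature.NumberTheory.EllipticCurves.Wuthrich2014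
  Literature.NumberTheory.EllipticCurves.SteinWuthrich2013
  Literature.NumberTheory.EllipticCurves.GreenbergVatsal2000
  Literature.NumberTheory.EllipticCurves.EmertonPollackWeston2006
  Literature.NumberTheory.QuadraticFields.Quadratic
  Summit.BirchSwinnertonDyer.Rank1Residual
  Summit.BirchSwinnertonDyer.Rank1Residual.RankZeroHeightFree
  Summit.BirchSwinnertonDyer.Rank1Residual.X11b.Three.Koly
  Summit.BirchSwinnertonDyer.BirchSwinnertonDyer.Theorems

/-! ### §1 The hybrid cut with the X11a lower half consumed ONLY at non-surjective, non-unit curves -/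

/-- **THE HYBRID CUT OF CRUX 19065 WITH SLOT 4 = THE LOWER HALF AT THE CORNER'S NON-SURJECTIVE LEAF TWINS.** As
`erratumRoadFive_nonSurjCorner_of_kolyZShaAn_of_kolyJMax_of_multiUpper_of_lowerX11aShaAn_of_twinMultDivisibility` (§1 of `…HybridShaAnCut`,
this seat g14), with the binder `h₄an` (X11a lower half at every curve with non-unit `#Ш_an`) replaced by **`h₄ℓ`**: the X11a lower half only
at NON-SURJECTIVE curves `Wd` with `p ∈ {5,7}`, `p ∣ ord_p Δ_min(Wd)` and `¬ X11a.ShaAnUnit Wd p` — 19064's registered `stub_lowerNonSurjDeep`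
restricted to the twins of item 19948. Proof VERBATIM otherwise: the upper half by carrier profile (the X₀(N) MAX road on `t = 0` ∕ mono-carrier
pairs reads the twin through `hLtw`, which already carries `¬ Surj Wd p` and `p ∣ ord_p Δ_min(Wd)`; `hUmulti` on the multi-carrier pairs is a
binder), then the lower half (trivial at `ord_p #Ш_an ≤ 0`, else `hZan` at a deep Hoffstein–Luo frame ∕ the seat's unconditional conductor-1
certificate at a shallow one). CONDITIONAL on every binder; does NOT close 19065; nothing booked; T7. [cite: Miller2011LMS, Def. 1.1] [cite: Cha2005, Thm. 21 and Rmk. 25 (pp. 173–175)] [cite: JetchevSkinnerWan2017, §7.4.1–7.4.2] -/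
theorem erratumRoadFive_nonSurjCorner_of_kolyZShaAn_of_kolyJMax_of_multiUpper_of_lowerLeafTwinDeep_of_twinMultDivisibility
    (hGZ : ∀ (N : ℕ) [NeZero N] (W : WeierstrassCurve ℚ) (K : Type) [Field K] [NumberField K],
      gross_zagier N W K)
    (hKo : ∀ (N : ℕ) [NeZero N] (W : WeierstrassCurve ℚ) (K : Type) [Field K] [NumberField K],
      kolyvagin N W K)
    (hWu : sha_dvd_analyticSha)
    (hGZK : rank_eq_analyticRank_of_analyticRank_le_one) (hmod : hasEntireLFunction_rat)
    (hnf : exists_isNewformOf) (hpar : nonempty_modularParametrizationData)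
    (hFHs : friedbergHoffstein_exists_heegnerField_split_twist_ne_zero)
    (hMaz : mazur_not_dvd_maninConstant_of_odd)
    (hrec : ∀ (N : ℕ) [NeZero N] (W : WeierstrassCurve ℚ) (K : Type) [Field K] [NumberField K],
      heegnerPointOfConductor_one_galoisConj N W K)
    (hD36 : ∀ (N : ℕ) [NeZero N] (W : WeierstrassCurve ℚ) (K : Type) [Field K] [NumberField K],
      phi_heegnerTau_mem_singularModuliField N W K)
    (hJs : thm61_splitMultiplicative) (hJn : thm61_nonsplitMultiplicative)
    (hGS : ∀ (W : WeierstrassCurve ℚ) [W.IsElliptic] [W.IsGloballyMinimal] (p : ℕ) [Fact p.Prime],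
      greenberg_stevens (W := W) (p := p))
    (hChaL : Cha2005.rmk25_pow_dvd_card_sha_primary_of_certificate)
    (hChaU : Cha2005.rmk25_padicValNat_card_sha_primary_add_le_of_globalDivisibility)
    -- the X11a lower half ONLY at NON-SURJECTIVE curves whose analytic `Ш` is NOT a `p`-adic unit
    -- with `p ∈ {5,7}` and `p ∣ ord_p Δ_min(Wd)` (19064's registered `stub_lowerNonSurjDeep` restricted to the LEAF twins of item 19948)
    (h₄ℓ : ∀ (Wd : WeierstrassCurve ℚ) [Wd.IsElliptic] [Wd.IsGloballyMinimal] (p : ℕ) [Fact p.Prime],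
      ClassX11a Wd p → ¬ Surj Wd p → (p = 5 ∨ p = 7) → p ∣ padicValInt p Wd.minimalDiscriminantInt →
      ¬ X11a.ShaAnUnit Wd p → Typed.MissingLowerBoundAt Wd p)
    -- Zₚᶜ ONLY at the corner pairs with `0 < ord_p #Ш(E)_an`, and only at the DEEP frames
    (hZan : ∀ (W : WeierstrassCurve ℚ) [W.IsElliptic] [W.IsGloballyMinimal] (p : ℕ) [Fact p.Prime]
      (N : ℕ) [NeZero N] (K : Type) [Field K] [NumberField K]
      (Dt : ModularParametrizationData W N) (β : ℤ) (ι : K →+* ℂ),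
      ClassX11b W p → ¬ Surj W p → (p = 5 ∨ p = 7) → p ∣ padicValInt p W.minimalDiscriminantInt →
      ¬ Ram W p → (∃ s : ℚ, shaAn W = (s : ℂ) ∧ 0 < padicValRat p s) →
      W.conductorNorm ℤ = N → IsImaginaryQuadratic K →
      4 < (NumberField.discr K).natAbs → SatisfiesHeegnerHypothesis N K →
      SatisfiesHeegnerHypothesis p K → (4 * (N : ℤ)) ∣ β ^ 2 - NumberField.discr K → ¬ (p : ℤ) ∣ Dt.c →
      (∃ (d₁ : KolyvaginHeegnerData Dt β ι 1) (y : (W.baseChange K).toAffine.Point),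
        WeierstrassCurve.Affine.Point.map (W' := W) (algebraMap K (ringClassField K ι 1)).toRatAlgHom y =
          d₁.derivedPoint ∧
        ∃ Q : (W.baseChange K).toAffine.Point, ((p ^ (padicValNat p W.tamagawaProduct + 1) : ℕ) : ℤ) • Q = y) →
      ∃ M : ℕ, M ≤ padicValNat p W.tamagawaProduct ∧ CertificateAt Dt β ι p M)
    (hJmax : ∀ (W : WeierstrassCurve ℚ) [W.IsElliptic] [W.IsGloballyMinimal] [NeZero (W.conductorNorm ℤ)]
      (p : ℕ) [Fact p.Prime] (K : Type) [Field K] [NumberField K]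
      (Dt : ModularParametrizationData W (W.conductorNorm ℤ)) (β : ℤ) (ι : K →+* ℂ),
      p ∣ W.tamagawaProduct →
      ClassX11b W p → ¬ Surj W p → (p = 5 ∨ p = 7) → p ∣ padicValInt p W.minimalDiscriminantInt →
      ¬ Ram W p → IsImaginaryQuadratic K → 4 < (NumberField.discr K).natAbs →
      SatisfiesHeegnerHypothesis (W.conductorNorm ℤ) K → SatisfiesHeegnerHypothesis p K →
      (4 * (W.conductorNorm ℤ : ℤ)) ∣ β ^ 2 - NumberField.discr K → ¬ (p : ℤ) ∣ Dt.c →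
      ∀ (v : HeightOneSpectrum (𝓞 ℚ)) (s : ℕ), s ≤ padicValNat p (W.tamagawaNumberAt v) →
        ∀ (n : ℕ) (d : KolyvaginHeegnerData Dt β ι n), Squarefree n →
          (∀ ℓ ∈ n.primeFactors, Zhang2014.IsKolyvaginPrime (W.conductorNorm ℤ) W K p ℓ ∧
            s ≤ Zhang2014.kolyvaginIndex W p ℓ) → PDiv d p s)
    (hUmulti : ∀ (W : WeierstrassCurve ℚ) [W.IsElliptic] [W.IsGloballyMinimal] (p : ℕ) [Fact p.Prime],
      ClassX11b W p → ¬ Surj W p → (p = 5 ∨ p = 7) → p ∣ padicValInt p W.minimalDiscriminantInt →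
      ¬ Ram W p → p ∣ W.tamagawaProduct →
      (∀ v : HeightOneSpectrum (𝓞 ℚ), padicValNat p (W.tamagawaNumberAt v) < padicValNat p W.tamagawaProduct) →
      Typed.MissingUpperBoundAt W p)
    (hdiv : ∀ (Wd : WeierstrassCurve ℚ) [Wd.IsElliptic] [Wd.IsGloballyMinimal] (p : ℕ) [Fact p.Prime],
      ClassX11a Wd p → ¬ Surj Wd p → (p = 5 ∨ p = 7) →
      p ∣ padicValInt p Wd.minimalDiscriminantInt → MultDivisibilityAt Wd p) :
    Summit.BirchSwinnertonDyer.BirchSwinnertonDyer.Theses.ErratumRoadFive.NonSurjCorner := by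
  intro W _ _ p _ hX hns h57 hv hnr
  have hp5 : 5 ≤ p := by rcases h57 with h | h <;> omega
  -- the X11a lower half at every NON-SURJECTIVE X11a LEAF twin at `p`: trivial at a unit `#Ш_an`, `h₄ℓ` otherwise
  have h₄ : ∀ (Wd : WeierstrassCurve ℚ) [Wd.IsElliptic] [Wd.IsGloballyMinimal], ClassX11a Wd p → ¬ Surj Wd p →
      p ∣ padicValInt p Wd.minimalDiscriminantInt → Typed.MissingLowerBoundAt Wd p := fun Wd _ _ hXa hnsd hvd ↦ by
    by_cases hu : X11a.ShaAnUnit Wd p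
    · obtain ⟨q, hq, hvq⟩ := hu
      exact ⟨q, hq, by rw [hvq]; exact_mod_cast Nat.zero_le _⟩
    · exact h₄ℓ Wd p hXa hnsd h57 hvd hu
  -- the Euler-system half of every non-surjective-leaf twin at this p, from the typed divisibility
  have hleafU : ∀ (Wd : WeierstrassCurve ℚ) [Wd.IsElliptic] [Wd.IsGloballyMinimal],
      ClassX11a Wd p → ¬ Surj Wd p → p ∣ padicValInt p Wd.minimalDiscriminantInt →
      Typed.MissingUpperBoundAt Wd p := fun Wd _ _ hXa hnsd hvd ↦
    missingUpperBoundAt_of_classX11a_of_multDivisibilityAt hJs hJn hGZK hmod hpar Wd p (hGS Wd p) hXa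
      (hdiv Wd p hXa hnsd h57 hvd)
  haveI : NeZero (W.conductorNorm ℤ) := ⟨(W.conductorNorm_pos_holds).ne'⟩
  -- the UPPER half, by CARRIER PROFILE (as in p579499)
  have hupper : Typed.MissingUpperBoundAt W p := by
    by_cases hcase : ¬ p ∣ W.tamagawaProduct ∨
        ∃ v : HeightOneSpectrum (𝓞 ℚ), padicValNat p W.tamagawaProduct ≤ padicValNat p (W.tamagawaNumberAt v)
    · refine missingUpperBoundAt_corner_of_jetchevDivisibility_of_twinLeafLower hGZ hKo hGZK hmod hnf hFHs hMaz
        hrec hD36 hChaU W p hX hns h57 hv hnr (fun Wd _ _ hXa hnsd hvd ↦ h₄ Wd hXa hnsd hvd) ?_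
      intro _ K _ _ Dt β ι hK hdisc hHN hHp hβ hc s hs n d hn hℓ
      rcases hcase with htam | ⟨v, hvt⟩
      · exact Summit.BirchSwinnertonDyer.BirchSwinnertonDyer.Theorems.nonSurjCornerKolyJ_of_not_dvd_tamagawa W p K
          Dt β ι htam hX hns h57 hv hnr hK hdisc hHN hHp hβ hc s hs n d hn hℓ
      · by_cases htam : p ∣ W.tamagawaProduct
        · exact hJmax W p K Dt β ι htam hX hns h57 hv hnr hK hdisc hHN hHp hβ hc v s (hs.trans hvt) n d hn hℓ
        · exact Summit.BirchSwinnertonDyer.BirchSwinnertonDyer.Theorems.nonSurjCornerKolyJ_of_not_dvd_tamagawa W p K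
            Dt β ι htam hX hns h57 hv hnr hK hdisc hHN hHp hβ hc s hs n d hn hℓ
    · push Not at hcase
      exact hUmulti W p hX hns h57 hv hnr hcase.1 hcase.2
  -- the LOWER half: trivial when `ord_p #Ш(E)_an ≤ 0`; otherwise Zₚᶜ at the Hoffstein–Luo frame (deep or shallow)
  obtain ⟨s, hs, hsv⟩ := hupper
  by_cases hs0 : padicValRat p s ≤ 0
  · exact Typed.missingPPartAt_of_lower_of_upper W p (missingLowerBoundAt_of_shaAn_nonpos W p hs hs0) ⟨s, hs, hsv⟩
  have hspos : ∃ s : ℚ, shaAn W = (s : ℂ) ∧ 0 < padicValRat p s := ⟨s, hs, lt_of_not_ge hs0⟩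
  refine Typed.missingPPartAt_of_lower_of_upper W p ?_ ⟨s, hs, hsv⟩
  refine missingLowerBoundAt_of_classX11b_of_indexLowerBoundNoSurj_of_upperTwist hGZ hKo hWu hGZK
    hmod hnf hFHs hMaz W p hX hp5
    (fun N _ K _ _ Dt H ι P hN hK hdisc hHN hHp hLt hP hc hPinf ↦
      indexLowerBoundAt_corner_of_certificates hGZ hKo hmod hrec hD36 hChaL W p N K Dt H ι P hX hp5 hN
        hK hdisc hHN hLt hP hPinf (by
          by_cases hdeep : ∃ (d₁ : KolyvaginHeegnerData Dt H.β ι 1) (y : (W.baseChange K).toAffine.Point),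
              WeierstrassCurve.Affine.Point.map (W' := W) (algebraMap K (ringClassField K ι 1)).toRatAlgHom y =
                d₁.derivedPoint ∧
              ∃ Q : (W.baseChange K).toAffine.Point, ((p ^ (padicValNat p W.tamagawaProduct + 1) : ℕ) : ℤ) • Q = y
          · exact hZan W p N K Dt H.β ι hX hns h57 hv hnr hspos hN hK hdisc hHN hHp H.dvd_sq_sub hc hdeep
          · push Not at hdeep
            exact nonSurjCornerKolyZ_of_bottom_not_pow_divisible' W p N K Dt H.β ι hX hns h57 hv hnr hN hK hdisc hHN
              hHp H.dvd_sq_sub hc (fun d₁ y hy hQ => by obtain ⟨Q, hQ⟩ := hQ; exact hdeep d₁ y hy Q hQ)))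
    ?_
  intro K _ _ Wd _ _ Cd hK hHN hLt hWd hnsd
  have hD0 : (NumberField.discr K : ℚ) ≠ 0 := by exact_mod_cast NumberField.discr_ne_zero K
  haveI : (W.quadraticTwist (NumberField.discr K : ℚ)).IsElliptic := W.isElliptic_quadraticTwist hD0
  have hrd : Wd.analyticRank = 0 := by
    rw [← hWd, analyticRank_smul]
    exact analyticRank_eq_zero_of_entireLFunction_one_ne_zero _ hLt
  have hXa : ClassX11a Wd p := classX11a_twist_of_not_ram W p hX hnr K hK hHN Cd hWd hrd
  have hpN : p ∣ W.conductorNorm ℤ := dvd_conductorNorm_of_mult hX.2.2.1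
  have hsq := isSquare_discr_padic_of_heegner K hK hHN p hpN
  have hvd : p ∣ padicValInt p Wd.minimalDiscriminantInt := by
    rw [padicValInt_minimalDiscriminantInt_twist_eq W p hD0 hsq Cd hWd]
    exact hv
  exact hleafU Wd hXa hnsd hvd

end Summit.BirchSwinnertonDyer.Rank1Residual.X11b

namespace Summit.BirchSwinnertonDyer.BirchSwinnertonDyer.Theorems

open CongruenceSubgroup WeierstrassCurve NumberField IsDedekindDomain Field Rat.HeightOneSpectrum
  Literature.NumberTheory.EllipticCurves
  Literature.NumberTheory.EllipticCurves.ModularForms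
  Literature.NumberTheory.EllipticCurves.Rank1Residual
  Literature.NumberTheory.EllipticCurves.Rank1Residual.Typed
  Literature.NumberTheory.EllipticCurves.Wuthrich2014
  Literature.NumberTheory.EllipticCurves.SteinWuthrich2013
  Literature.NumberTheory.EllipticCurves.Greenberg1999
  Literature.NumberTheory.EllipticCurves.Kato2004
  Literature.NumberTheory.EllipticCurves.BarriosEtAl2025
  Literature.NumberTheory.GaloisRepresentations Literature.NumberTheory.GaloisCohomology
  Literature.NumberTheory.Automorphic
  Summit.BirchSwinnertonDyer.Rank1Residual
  Summit.BirchSwinnertonDyer.Rank1Residual.X11b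
  Summit.BirchSwinnertonDyer.Rank1Residual.X11b.Three.Koly

/-! ### §2 Glue #8: the full hybrid composition, slot 4 = 19064's non-surjective stub, §2 roads on the twin-lower supply -/

/-- **THE HYBRID GLUE (glue #8) — SLOT 4 NARROWED (RULING 48).** As glue #7 (`…HybridShaAnCut` §2): `hZan` (Kolyvagin certificates only at the
corner pairs with `0 < ord_p #Ш(E)_an`, only at DEEP frames) → `NonSurjCornerTwinMuAn` (19948) → `KatoTwinFactsFiveAn` (19949) → **`h₄ℓ`**
(the X11a lower half only at NON-SURJECTIVE curves with `p ∈ {5,7}`, `p ∣ ord_p Δ_min` and non-unit `#Ш_an` — the rank-0 LEAF TWINS of item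
19948; = 19064's registered `stub_lowerNonSurjDeep` restricted to them) → hMax (3 names) → hShim6 (6 names) → the SAVED display → `hres3bad` →
`NonSurjCorner`. Inside: at each multi-carrier corner pair the TWIN-LOWER SUPPLY `FHTwinLowerSupplyAt W p` is produced from Friedberg–Hoffstein
(`hShim6.1`) ∧ `h₄ℓ` (`NonSurjCorner.fhTwinLowerSupplyAt_of_lowerLeafTwinDeep`: the twist of a non-surjective corner curve is a non-surjective
leaf twin) and fed to the supply-keyed
§2 roads (`NonSurjCorner.missingUpperBoundAt_of_admissibleSet_of_primitives_of_twinLower` ∕ `…_of_admissibleUpToOne_of_savedDisplay_of_twinLower`);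
the Poitou–Tate sum formula and Barrios et al.'s `c₂` are tree theorems. Item 19064 WHOLE (`X11aLowerHalf`) implies `h₄ℓ` a fortiori, so r5's
composition factors through this one. CONDITIONAL on every binder; 19065 NOT closed; nothing booked; T7.
[cite: Miller2011LMS, Def. 1.1] [cite: Cha2005, Thm. 21 and Rmk. 25] [cite: JetchevSkinnerWan2017, §7.4.2] [cite: PapikianRabinoff2016, Cor. 3.5]
[cite: SilvermanAEC2009, X.5 Cor. 5.4] [cite: FriedbergHoffstein1995, Thm. B] -/
theorem nonSurjCorner_of_kolyZShaAn_of_twinMuAn_of_katoFacts_of_lowerLeafTwinDeep_of_sixNamedInputs_of_savedDisplay_of_threeBadSplit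
    (hZan : ∀ (W : WeierstrassCurve ℚ) [W.IsElliptic] [W.IsGloballyMinimal] (p : ℕ) [Fact p.Prime]
      (N : ℕ) [NeZero N] (K : Type) [Field K] [NumberField K]
      (Dt : ModularParametrizationData W N) (β : ℤ) (ι : K →+* ℂ),
      ClassX11b W p → ¬ Surj W p → (p = 5 ∨ p = 7) → p ∣ padicValInt p W.minimalDiscriminantInt →
      ¬ Ram W p → (∃ s : ℚ, shaAn W = (s : ℂ) ∧ 0 < padicValRat p s) →
      W.conductorNorm ℤ = N → IsImaginaryQuadratic K →
      4 < (NumberField.discr K).natAbs → SatisfiesHeegnerHypothesis N K →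
      SatisfiesHeegnerHypothesis p K → (4 * (N : ℤ)) ∣ β ^ 2 - NumberField.discr K → ¬ (p : ℤ) ∣ Dt.c →
      (∃ (d₁ : KolyvaginHeegnerData Dt β ι 1) (y : (W.baseChange K).toAffine.Point),
        WeierstrassCurve.Affine.Point.map (W' := W) (algebraMap K (ringClassField K ι 1)).toRatAlgHom y =
          d₁.derivedPoint ∧
        ∃ Q : (W.baseChange K).toAffine.Point, ((p ^ (padicValNat p W.tamagawaProduct + 1) : ℕ) : ℤ) • Q = y) →
      ∃ M : ℕ, M ≤ padicValNat p W.tamagawaProduct ∧ CertificateAt Dt β ι p M)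
    (hμ : NonSurjCornerTwinMuAn)
    (hF : Summit.BirchSwinnertonDyer.BirchSwinnertonDyer.Theses.ErratumRoadFive.KatoTwinFactsFiveAn)
    (h₄ℓ : ∀ (Wd : WeierstrassCurve ℚ) [Wd.IsElliptic] [Wd.IsGloballyMinimal] (p : ℕ) [Fact p.Prime],
      ClassX11a Wd p → ¬ Surj Wd p → (p = 5 ∨ p = 7) → p ∣ padicValInt p Wd.minimalDiscriminantInt →
      ¬ X11a.ShaAnUnit Wd p → Typed.MissingLowerBoundAt Wd p)
    (hMax : GrossLMS1991.prop37_2_frobeniusCongruence ∧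
      (∀ (K : Type) [Field K] [NumberField K], poitouTate_selmerStructure_duality_conj K) ∧
      Gross1991_heegnerPoint_sub_ratTorsion_mem_E0_imageFree)
    (hShim6 : friedbergHoffstein_exists_twist_ne_zero_inertAt ∧ nonempty_shimuraParametrizationData ∧
      PastenShimura2024_componentOrders ∧
      (∀ (K : Type) [Field K] [NumberField K], casselsTate_levelInputs K) ∧
      shimuraCurve_heegnerSystem_primitivesFromFiveIrr ∧ shimuraCurve_heegnerSystem_primitivesSplitReduced)
    (hSav : ∀ (W : WeierstrassCurve ℚ) [W.IsElliptic] [W.IsGloballyMinimal] (p : ℕ) [Fact p.Prime],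
      ClassX11b W p → ¬ Surj W p → (p = 5 ∨ p = 7) → ∀ (q₁ : ℕ) [Fact q₁.Prime], ShimuraInertSavedDisplayAt W p q₁)
    (hres3bad : ∀ (W : WeierstrassCurve ℚ) [W.IsElliptic] [W.IsGloballyMinimal] (p : ℕ) [Fact p.Prime],
      ClassX11b W p → ¬ Surj W p → (p = 5 ∨ p = 7) → p ∣ padicValInt p W.minimalDiscriminantInt → ¬ Ram W p →
      ∀ (q₁ q₂ q₃ : ℕ) [Fact q₁.Prime] [Fact q₂.Prime] [Fact q₃.Prime], q₁ ≠ p → q₂ ≠ p → q₃ ≠ p →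
      q₁ ≠ q₂ → q₁ ≠ q₃ → q₂ ≠ q₃ →
      W.HasSplitMultiplicativeReductionAtPrime q₁ → W.HasSplitMultiplicativeReductionAtPrime q₂ →
      W.HasSplitMultiplicativeReductionAtPrime q₃ →
      (q₁ = 2 ∨ p ∣ q₁ - 1) → (q₂ = 2 ∨ p ∣ q₂ - 1) → (q₃ = 2 ∨ p ∣ q₃ - 1) → Typed.MissingUpperBoundAt W p) :
    Summit.BirchSwinnertonDyer.BirchSwinnertonDyer.Theses.ErratumRoadFive.NonSurjCorner := by
  obtain ⟨hGZ, hKo, hWu, hGZK, hmod, hnf, hpar, hFHs, hMaz, hrec, hD36, hJs, hJn, hGS, hChaL, hChaU, hne, h12,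
    hns, hsp, h15, h18, hfine⟩ := hF
  obtain ⟨h37, hPTs, hF1⟩ := hMax
  obtain ⟨hFH, hJL, hCO, hCT, hLab, hLabS⟩ := hShim6
  have hPT : ∀ (K : Type) [Field K] [NumberField K],
      Literature.NumberTheory.GaloisCohomology.poitouTate_sum_localTatePairing_eq_zero K :=
    poitouTate_sum_localTatePairing_eq_zero_holds
  have hBR : localTamagawaNumber_quadraticTwist_two_mem_of_goodReduction :=
    BarriosEtAl2025.localTamagawaNumber_quadraticTwist_two_mem_of_goodReduction_holds
  exact X11b.erratumRoadFive_nonSurjCorner_of_kolyZShaAn_of_kolyJMax_of_multiUpper_of_lowerLeafTwinDeep_of_twinMultDivisibility hGZ hKo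
    hWu hGZK hmod hnf hpar hFHs hMaz hrec hD36 hJs hJn hGS hChaL hChaU h₄ℓ hZan
    (X11b.Three.Koly.nonSurjCornerKolyJ_max_of_threeNamedFacts h37 hPTs hF1)
    (fun W _ _ p _ hX hns' h57 hv hnr htam hmulti ↦ by
      -- the TWIN-LOWER SUPPLY at this corner pair: Friedberg–Hoffstein + the X11a lower half at NON-SURJECTIVE curves (the twist is one)
      have hTL : FHTwinLowerSupplyAt W p :=
        NonSurjCorner.fhTwinLowerSupplyAt_of_lowerLeafTwinDeep hGZK hmod hnf hFH h₄ℓ W p hX hns' h57 hv hnr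
      by_cases h3 : ∃ (q₁ q₂ q₃ : ℕ) (_ : Fact q₁.Prime) (_ : Fact q₂.Prime) (_ : Fact q₃.Prime), q₁ ≠ p ∧ q₂ ≠ p ∧ q₃ ≠ p ∧
          q₁ ≠ q₂ ∧ q₁ ≠ q₃ ∧ q₂ ≠ q₃ ∧ W.HasSplitMultiplicativeReductionAtPrime q₁ ∧
          W.HasSplitMultiplicativeReductionAtPrime q₂ ∧ W.HasSplitMultiplicativeReductionAtPrime q₃ ∧
          (q₁ = 2 ∨ p ∣ q₁ - 1) ∧ (q₂ = 2 ∨ p ∣ q₂ - 1) ∧ (q₃ = 2 ∨ p ∣ q₃ - 1)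
      · obtain ⟨q₁, q₂, q₃, i₁, i₂, i₃, h1p, h2p, h3p, h12', h13, h23, hs1, hs2, hs3, hb1, hb2, hb3⟩ := h3
        haveI := i₁; haveI := i₂; haveI := i₃
        exact hres3bad W p hX hns' h57 hv hnr q₁ q₂ q₃ h1p h2p h3p h12' h13 h23 hs1 hs2 hs3 hb1 hb2 hb3
      · have hno : ∀ (q₁ q₂ q₃ : ℕ) [Fact q₁.Prime] [Fact q₂.Prime] [Fact q₃.Prime], q₁ ≠ p → q₂ ≠ p → q₃ ≠ p →
            q₁ ≠ q₂ → q₁ ≠ q₃ → q₂ ≠ q₃ →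
            W.HasSplitMultiplicativeReductionAtPrime q₁ → W.HasSplitMultiplicativeReductionAtPrime q₂ →
            W.HasSplitMultiplicativeReductionAtPrime q₃ →
            (q₁ = 2 ∨ p ∣ q₁ - 1) → (q₂ = 2 ∨ p ∣ q₂ - 1) → (q₃ = 2 ∨ p ∣ q₃ - 1) → False :=
          fun q₁ q₂ q₃ _ _ _ h1p h2p h3p h12' h13 h23 hs1 hs2 hs3 hb1 hb2 hb3 ↦
            h3 ⟨q₁, q₂, q₃, inferInstance, inferInstance, inferInstance, h1p, h2p, h3p, h12', h13, h23, hs1, hs2, hs3,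
              hb1, hb2, hb3⟩
        rcases NonSurjCorner.admissibleUpToOneDatum_of_atMostTwoBadSplit W p hX hns' h57 htam hmulti hno with
          hadm | ⟨q₁, hq₁F, hq₁, hdat⟩
        · exact NonSurjCorner.missingUpperBoundAt_of_admissibleSet_of_primitives_of_twinLower hGZK hmod hnf hMaz hBR hJL hCO hPT hCT
            hLab hLabS W p hX h57 hTL hadm
        · haveI := hq₁F
          exact NonSurjCorner.missingUpperBoundAt_of_admissibleUpToOne_of_savedDisplay_of_twinLower hGZK hmod hnf hMaz hBR hJL hCO W p
            hX h57 hTL q₁ hq₁ (hSav W p hX hns' h57 q₁) hdat)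
    (fun Wd _ _ p _ hXa hnsd h57 hvd ↦
      X11b.multDivisibilityAt_of_katoFacts_of_muAn hne h12 hns hsp h15 h18 hfine Wd p hXa.2.1 hXa.2.2.1
        hXa.2.2.2.1 hnsd (fun f hf ϖ hϖ a L hsa hna hL ↦ hμ Wd p hXa hnsd h57 hvd f hf ϖ hϖ a L hsa hna hL))

/-- **r5's composition factors through glue #8**: item 19064 WHOLE (`X11aLowerHalf`, the statement of r5's slot 4 `stub_lowerX11a57`)
implies the narrowed binder `h₄ℓ` a fortiori — so registering r6 (slot 4 ↦ the leaf-twin stub) loses nothing. Pure logic.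
[cite: Miller2011LMS, Def. 1.1] -/
theorem lowerLeafTwinDeep_of_x11aLowerHalf
    (h₄ : Summit.BirchSwinnertonDyer.BirchSwinnertonDyer.Theses.ErratumRoadFive.X11aLowerHalf) :
    ∀ (Wd : WeierstrassCurve ℚ) [Wd.IsElliptic] [Wd.IsGloballyMinimal] (p : ℕ) [Fact p.Prime],
      ClassX11a Wd p → ¬ Surj Wd p → (p = 5 ∨ p = 7) → p ∣ padicValInt p Wd.minimalDiscriminantInt →
      ¬ X11a.ShaAnUnit Wd p → Typed.MissingLowerBoundAt Wd p :=
  fun Wd _ _ p _ hXa _ _ _ _ ↦ h₄ Wd p hXa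

/-- **19064's registered `stub_lowerNonSurjDeep` (its statement, `Cruxes/X11aLowerHalf/Lines/birth.lean`, quantified over every prime)
implies the narrowed binder `h₄ℓ`** a fortiori. Pure logic. [cite: Miller2011LMS, Def. 1.1] -/
theorem lowerLeafTwinDeep_of_lowerNonSurjDeep
    (h : ∀ (Wd : WeierstrassCurve ℚ) [Wd.IsElliptic] [Wd.IsGloballyMinimal] (p : ℕ) [Fact p.Prime],
      ClassX11a Wd p → ¬ Surj Wd p → ¬ X11a.ShaAnUnit Wd p → Typed.MissingLowerBoundAt Wd p) :
    ∀ (Wd : WeierstrassCurve ℚ) [Wd.IsElliptic] [Wd.IsGloballyMinimal] (p : ℕ) [Fact p.Prime],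
      ClassX11a Wd p → ¬ Surj Wd p → (p = 5 ∨ p = 7) → p ∣ padicValInt p Wd.minimalDiscriminantInt →
      ¬ X11a.ShaAnUnit Wd p → Typed.MissingLowerBoundAt Wd p :=
  fun Wd _ _ p _ hXa hnsd _ _ hu ↦ h Wd p hXa hnsd hu

end Summit.BirchSwinnertonDyer.BirchSwinnertonDyer.Theorems

end
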